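import Literature.Computability.Complexity.GoldwasserSipserRefereeBricks
import HarnessLib

/-!
# The Goldwasser–Sipser referee, II: agreement with the game

Fourth file of the PROOF of the Goldwasser–Sipser theorem (`IP[k] ⊆ AM[k+2]` for constant `k`,
Arora–Barak Thm. 8.12; the named fact
`Literature.Computability.Complexity.GoldwasserSipser1986_IPk_subset_AMk` of `ArthurMerlinGames.lean`).
`GoldwasserSipserGame.lean` defines the public-coin simulation game `GoldwasserSipser.Accepts p G`
of a private-coin game `G` abstractly (parsed states, value-to-go, soundness, completeness in
`GoldwasserSipserCompleteness.lean`); `GoldwasserSipserRefereeBricks.lean` writes a polynomial-time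
referee `GSRef.gsRef W γ kf R ∈ P` in the `FP` brick algebra and proves the values of its checks on
round records. This file closes the gap: on complete histories (`2R + 3` moves of the common move
length `M`) the referee language ACCEPTS EXACTLY the histories the game accepts, for the game
`G = W.game x m ℓ` of the simulated verifier on the input (`InteractiveProofValues.lean`) and any
parameters `p` with `p.ℓ = coins(|x|)`, `p.m = msgLen(|x|)`, `p.β = size (ℓ + 1)` (the bucket
exponent as the referee computes it), slack `p.γ`, move length `p.M ≥ max (2m) ℓ`:

* `GSRef.consistent_game_iff_replayModel` — consistency of coins with a private-coin transcript
  (`PCGame.Consistent`) is the string identity "replaying `W` on the coins against the recorded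
  prover answers reproduces the transcript" (`GSRef.replayModel`), by induction on the rounds;
* `GSRef.chkF_rec_iff_roundsAccept` — the referee's checks from a round record pass iff the game
  accepts the remaining moves from the corresponding parsed state (induction on the rounds,
  using the brick values `roundOkF_eq_true_iff`, `stepF_apply`, `finalHashF_eq_true_iff`,
  `consistF_eq_true_iff`, `acceptF_eq_true_iff` of the previous file);
* **`GSRef.mem_gsRef_iff_accepts`** and **`GSRef.refereePayoff_gsRef_eq_payoff`**: on complete
  histories `boolPair x (enc h) ∈ gsRef ↔ GoldwasserSipser.Accepts p G h`, so the referee payoff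
  of `ArthurMerlinGames.lean` is the game's payoff and (`gameValue_congr_on`)
  **`GSRef.amValue_gsRef_eq`**: Merlin's winning chance against the referee is the value of the
  Goldwasser–Sipser game. The assembly of the theorem is `GoldwasserSipserAssembly.lean`.

All proved, no definitions; [folklore] glue throughout (the sources treat "the new referee
checks …" as evident).

## References

* S. Arora, B. Barak, *Computational Complexity: A Modern Approach*, CUP 2009, §8.2.3 (sketch of
  the proof of Thm. 8.12), Def. 8.6.
* S. Goldwasser, M. Sipser, *Private coins versus public coins in interactive proof systems*,
  STOC 1986, 59–68, §4.
* L. Babai, S. Moran, *Arthur–Merlin games …*, JCSS 36 (1988), §2.5 ("the new referee acts in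
  polynomial time, using the old verifier as a subroutine").
-/

noncomputable section

namespace Literature.Computability.Complexity

open _root_.Computability Finset Polynomial Brick Plumb OracleCompose HashBricks Kannan Stockmeyer
  AMPlayer GoldwasserSipser

open scoped Classical

namespace GSRef

variable (W : IPVerifier) (x : List Bool) (m ℓ : ℕ)

/-! ### Consistency of coins with a transcript is the replay identity -/

/-- The replay model only reads the recorded prover answers (odd positions below `2i`).
[folklore] -/
theorem replayModel_congr (r : List Bool) {τ τ' : List (List Bool)} :
    ∀ i : ℕ, (∀ j < i, τ.getD (2 * j + 1) [] = τ'.getD (2 * j + 1) []) →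
      replayModel W x r m τ i = replayModel W x r m τ' i
  | 0, _ => rfl
  | i + 1, h => by
    simp only [replayModel]
    rw [replayModel_congr r i fun j hj => h j (Nat.lt_succ_of_lt hj), h i (Nat.lt_succ_self i)]

/-- A list of length `n + 2` is a list of length `n` followed by two items. [folklore] -/
theorem exists_eq_append_pair {α : Type*} {n : ℕ} (l : List α) (h : l.length = n + 2) :
    ∃ (l₀ : List α) (a a' : α), l = l₀ ++ [a, a'] ∧ l₀.length = n := by
  rcases List.eq_nil_or_concat l with rfl | ⟨L, a', rfl⟩
  · simp at h
  rcases List.eq_nil_or_concat L with rfl | ⟨L', a, rfl⟩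
  · simp at h
  refine ⟨L', a, a', by simp, ?_⟩
  simpa using h

/-- **Consistency is the replay identity**: coins `r` are consistent with a private-coin
transcript `τ` of `i` complete rounds (every verifier message in `τ` is the one `W` sends on `r`
after the preceding messages, `PCGame.Consistent` for the game `W.game x m ℓ`) iff replaying `W` on
`r` against the prover answers recorded in `τ` reproduces `τ`. [cite: AroraBarakCC2009, §8.2.3] -/
theorem consistent_game_iff_replayModel (r : List.Vector Bool ℓ) :
    ∀ (i : ℕ) (τ : List (List.Vector Bool m)), τ.length = 2 * i →
      ((W.game x m ℓ).Consistent r τ ↔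
        replayModel W x r.toList m (τ.map List.Vector.toList) i = τ.map List.Vector.toList)
  | 0, τ, hτ => by
    obtain rfl : τ = [] := List.eq_nil_of_length_eq_zero hτ
    simp [replayModel, PCGame.consistent_nil]
  | i + 1, τ, hτ => by
    obtain ⟨τ₀, a, a', rfl, hτ₀⟩ := exists_eq_append_pair (n := 2 * i) τ (by rw [hτ]; ring)
    have he : Even τ₀.length := ⟨i, by rw [hτ₀]; ring⟩
    have ho : ¬Even (τ₀ ++ [a]).length := by
      simp only [List.length_append, List.length_singleton, Nat.even_add_one, not_not]; exact he
    -- game side: one verifier message, one free prover message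
    have hgame : (W.game x m ℓ).Consistent r (τ₀ ++ [a, a']) ↔
        (W.game x m ℓ).Consistent r τ₀ ∧ a = (W.game x m ℓ).next r τ₀ := by
      rw [show τ₀ ++ [a, a'] = (τ₀ ++ [a]) ++ [a'] by simp,
        (W.game x m ℓ).consistent_append_iff_of_not_even r ho,
        (W.game x m ℓ).consistent_append_iff_of_even r he]
    -- replay side
    set T₀ := τ₀.map List.Vector.toList with hT₀
    have hT : (τ₀ ++ [a, a']).map List.Vector.toList = T₀ ++ [a.toList, a'.toList] := by simp [hT₀]
    have hlenT₀ : T₀.length = 2 * i := by rw [hT₀, List.length_map, hτ₀]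
    have hcongr : replayModel W x r.toList m (T₀ ++ [a.toList, a'.toList]) i = replayModel W x r.toList m T₀ i :=
      replayModel_congr W x m r.toList i fun j hj => by
        rw [List.getD_append _ _ _ _ (by rw [hlenT₀]; omega)]
    have hget : (T₀ ++ [a.toList, a'.toList]).getD (2 * i + 1) [] = a'.toList := by
      rw [List.getD_append_right _ _ _ _ (by rw [hlenT₀]; omega), hlenT₀,
        show 2 * i + 1 - 2 * i = 1 by omega]
      rfl
    have IH := consistent_game_iff_replayModel r i τ₀ hτ₀
    rw [hgame, hT, replayModel, hcongr, hget, List.take_of_length_le (by rw [a'.toList_length]), IH]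
    constructor
    · rintro ⟨h0, rfl⟩
      rw [h0]
      rfl
    · intro h
      obtain ⟨h0, h1⟩ := List.append_inj' h rfl
      refine ⟨h0, List.Vector.eq _ _ ?_⟩
      rw [h0] at h1
      have h2 := (List.cons.inj h1).1
      rw [← h2]
      rfl

/-! ### The verdict of the simulated verifier after the last prover message -/

/-- **The verdict after the last prover message**: with `kf ≤ 1` verifier messages left (played
against the dummy strategy `noStrat`, which is never consulted) the game of `W` accepts the coins
`r` iff `W`'s verdict accepts the view of the transcript, completed by `W`'s own last message when
`kf = 1`. [cite: AroraBarakCC2009, Def. 8.6] -/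
theorem game_accept_play_noStrat_iff (r : List.Vector Bool ℓ) {kf : ℕ} (hkf : kf ≤ 1)
    (τ : List (List.Vector Bool m)) (he : Even τ.length) :
    (W.game x m ℓ).accept r ((W.game x m ℓ).play r (noStrat m) kf τ) ↔
      IPVerifier.view x r.toList (if kf = 0 then τ.map List.Vector.toList
        else τ.map List.Vector.toList ++ [W.vmsg x m r.toList (τ.map List.Vector.toList)]) ∈ W.verdict := by
  rcases Nat.le_one_iff_eq_zero_or_eq_one.1 hkf with rfl | rfl
  · rw [PCGame.play_zero, if_pos rfl, IPVerifier.game_accept_iff]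
  · rw [PCGame.play_succ, if_pos he, PCGame.play_zero, if_neg Nat.one_ne_zero, IPVerifier.game_accept_iff,
      List.map_append, List.map_singleton, IPVerifier.toList_game_next]

/-! ### The referee's checks agree with the game, round by round

The game's numerical parameters `p : Params` are those of `W` on the input at hand when
`coins(|x|) = p.ℓ`, `msgLen(|x|) = p.m` and `size (coins(|x|) + 1) = p.β` (the bucket exponent the
referee computes, `GSRef.betaU_apply`); the referee is run with slack `p.γ`, `p.kFin` final verifier
messages and `p.R` rounds, on moves of length `p.M ≥ max (2 p.m) p.ℓ`. -/

section Agreement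

variable (p : Params) (hℓ : W.coins.eval x.length = p.ℓ) (hm : W.msgLen.eval x.length = p.m)
  (hβ : (W.coins.eval x.length + 1).size = p.β)

/-- A coded list of `2i` messages has length `≥ i` (so that `replayFn_apply` applies). [folklore] -/
theorem le_length_encList_of_length_eq {T : List (List Bool)} {i : ℕ} (hT : T.length = 2 * i) :
    i ≤ (encList T).length := by
  rw [length_encList]
  have h : ∀ L : List (List Bool), L.length ≤ (L.map fun a => 2 * a.length + 2).sum := by
    intro L
    induction L with
    | nil => simp
    | cons a L ih => simp only [List.map_cons, List.sum_cons, List.length_cons]; omega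
  have := h T
  omega

include hℓ hm in
/-- **The final test agrees with the final check of the game.** From a parsed state `st` with `i`
complete rounds recorded, on the last two moves `u` (Arthur's hash) and `w` (Merlin's coins) of
length `M ≥ ℓ`: the referee's final test passes and all earlier hash checks passed (`st.ok`) iff
`GoldwasserSipser.Final`. [cite: AroraBarakCC2009, §8.2.3] -/
theorem finalOkF_rec_iff_final (hMℓ : p.ℓ ≤ p.M) (st : State p.m) (i : ℕ) (hτ : st.τ.length = 2 * i)
    (u w : List Bool) (hw : w.length = p.M) :
    (finalOkF W p.γ p.kFin
        (rec6 x (ones st.κ) (ones st.j) (encList (st.τ.map List.Vector.toList)) (ones i)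
          (boolPair u (boolPair w []))) = [true] ∧ st.ok ↔
      Final p (W.game x p.m p.ℓ) st u w) := by
  have hr : (coinsOf p w).toList = w.take p.ℓ := toList_coinsOf p (by omega)
  have he : Even st.τ.length := ⟨i, by rw [hτ]; ring⟩
  have hkf : p.kFin ≤ 1 := p.kFin_le_one
  -- the three tests of the referee
  have h1 : finalHashF W p.γ (rec6 x (ones st.κ) (ones st.j) (encList (st.τ.map List.Vector.toList)) (ones i)
      (boolPair u (boolPair w []))) = [true] ↔ HashesToZero u p.ℓ (st.κ - p.γ) (coinsOf p w).toList := by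
    rw [finalHashF_eq_true_iff, hr, hℓ]
  have h2 : consistF W (rec6 x (ones st.κ) (ones st.j) (encList (st.τ.map List.Vector.toList)) (ones i)
      (boolPair u (boolPair w []))) = [true] ↔ (W.game x p.m p.ℓ).Consistent (coinsOf p w) st.τ := by
    rw [consistent_game_iff_replayModel W x p.m p.ℓ (coinsOf p w) i st.τ hτ, hr]
    rcases Nat.eq_zero_or_pos i with rfl | hi
    · obtain hnil : st.τ = [] := List.eq_nil_of_length_eq_zero hτ
      rw [hnil, List.map_nil]
      simp only [replayModel, iff_true]
      exact consistF_eq_true_zero W x _ _ u w []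
    · have h := consistF_eq_true_iff W x (ones st.κ) (ones st.j) (st.τ.map List.Vector.toList) hi
        (le_length_encList_of_length_eq (by rw [List.length_map, hτ])) u w []
      rw [hℓ, hm] at h
      exact h
  have h3 : acceptF W p.kFin (rec6 x (ones st.κ) (ones st.j) (encList (st.τ.map List.Vector.toList)) (ones i)
      (boolPair u (boolPair w []))) = [true] ↔
      (W.game x p.m p.ℓ).accept (coinsOf p w) ((W.game x p.m p.ℓ).play (coinsOf p w) (noStrat p.m) p.kFin st.τ) := by
    have h := acceptF_eq_true_iff W p.kFin x hkf (ones st.κ) (ones st.j) (st.τ.map List.Vector.toList) i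
      (by rw [List.length_map, hτ]) u w []
    rw [hℓ, hm] at h
    rw [h, game_accept_play_noStrat_iff W x p.m p.ℓ (coinsOf p w) hkf st.τ he, hr]
  rw [finalOkF_eq_true_iff, h1, h2, h3]
  exact ⟨fun h => ⟨h.2, h.1⟩, fun h => ⟨h.2, h.1⟩⟩

/-- The code of a transcript grown by one round. [folklore] -/
theorem encList_append_pair (T : List (List Bool)) (a a' : List Bool) :
    encList T ++ boolPair a (boolPair a' []) = encList (T ++ [a, a']) := by
  rw [Boards.encList_append, encList_cons, encList_cons, encList_nil]

include hℓ hm hβ in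
/-- **The referee's checks agree with the game, round by round.** From a parsed state `st` with
`i` complete rounds recorded and `n` hashing rounds to go, on remaining moves `rest` (exactly
`2n + 2` moves of the common length `M`, `M ≥ 2m`, `M ≥ ℓ`): the referee's checks `chkF n` pass on
the round record of `st` and all earlier hash checks passed (`st.ok`) iff the game accepts the
remaining moves from `st` (`GoldwasserSipser.RoundsAccept`). [cite: AroraBarakCC2009, §8.2.3] -/
theorem chkF_rec_iff_roundsAccept (hM2 : 2 * p.m ≤ p.M) (hMℓ : p.ℓ ≤ p.M) :
    ∀ (n : ℕ) (st : State p.m) (i : ℕ) (rest : List (List Bool)),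
      st.τ.length = 2 * i → rest.length = 2 * n + 2 → (∀ w ∈ rest, w.length = p.M) →
      (chkF W p.γ p.kFin n
          (rec6 x (ones st.κ) (ones st.j) (encList (st.τ.map List.Vector.toList)) (ones i) (encList rest)) = [true] ∧
          st.ok ↔
        RoundsAccept p (W.game x p.m p.ℓ) n st rest)
  | 0, st, i, rest, hτ, hrest, hlen => by
    -- the last two moves
    obtain ⟨r₀, u, w, rfl, hr₀⟩ := exists_eq_append_pair (n := 0) rest hrest
    obtain rfl : r₀ = [] := List.eq_nil_of_length_eq_zero hr₀
    simp only [List.nil_append] at hlen ⊢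
    rw [encList_cons, encList_cons, encList_nil, chkF]
    exact finalOkF_rec_iff_final W x p hℓ hm hMℓ st i hτ u w (hlen w (by simp))
  | n + 1, st, i, rest, hτ, hrest, hlen => by
    -- the next two moves
    obtain ⟨u, rest₁, rfl⟩ : ∃ u rest₁, rest = u :: rest₁ := by
      rcases rest with _ | ⟨u, rest₁⟩
      · simp at hrest
      · exact ⟨u, rest₁, rfl⟩
    obtain ⟨w, rest', rfl⟩ : ∃ w rest', rest₁ = w :: rest' := by
      rcases rest₁ with _ | ⟨w, rest'⟩
      · simp at hrest
      · exact ⟨w, rest', rfl⟩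
    have hw : w.length = p.M := hlen w (by simp)
    have hrest' : rest'.length = 2 * n + 2 := by simp only [List.length_cons] at hrest; omega
    have hlen' : ∀ w' ∈ rest', w'.length = p.M := fun w' hw' => hlen w' (by simp [hw'])
    -- the parsed pieces of Merlin's move
    have hvm : (vmOf p w).toList = w.take p.m := toList_vmOf p (by omega)
    have hpm : (pmOf p w).toList = (w.drop p.m).take p.m := toList_pmOf p (by omega)
    have hbkt : bktU W (boolPair x w) = ones (bktOf p w) := by rw [bktU_apply, hm, hℓ]; rfl
    -- the record after the round is the record of the stepped state
    have hstep : stepF W (rec6 x (ones st.κ) (ones st.j) (encList (st.τ.map List.Vector.toList)) (ones i)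
        (encList (u :: w :: rest'))) =
        rec6 x (ones (step p st u w).κ) (ones (step p st u w).j)
          (encList ((step p st u w).τ.map List.Vector.toList)) (ones (i + 1)) (encList rest') := by
      rw [encList_cons, encList_cons, stepF_apply, hbkt, encList_append_pair, hm]
      simp only [step, List.map_append, List.map_cons, List.map_nil, hvm, hpm]
      simp [ones, List.replicate_succ]
    have hτ' : (step p st u w).τ.length = 2 * (i + 1) := by
      simp only [step, List.length_append, List.length_cons, List.length_nil, hτ]
      omega
    have IH := chkF_rec_iff_roundsAccept hM2 hMℓ n (step p st u w) (i + 1) rest' hτ' hrest' hlen'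
    have hround : roundOkF W p.γ (rec6 x (ones st.κ) (ones st.j) (encList (st.τ.map List.Vector.toList)) (ones i)
        (encList (u :: w :: rest'))) = [true] ↔ HashesToZero u p.m (bLen p st) (vmOf p w).toList := by
      rw [encList_cons, encList_cons, roundOkF_eq_true_iff, hvm, hm, hβ]; rfl
    have hunf : RoundsAccept p (W.game x p.m p.ℓ) (n + 1) st (u :: w :: rest') ↔
        RoundsAccept p (W.game x p.m p.ℓ) n (step p st u w) rest' := Iff.rfl
    have hok : (step p st u w).ok ↔ st.ok ∧ HashesToZero u p.m (bLen p st) (vmOf p w).toList := Iff.rfl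
    rw [chkF_succ_eq_true_iff]
    rw [hround]
    rw [hstep]
    rw [hunf]
    rw [← IH]
    rw [hok]
    exact ⟨fun h => ⟨h.1.2, h.2, h.1.1⟩, fun h => ⟨⟨h.2.2, h.1⟩, h.2.1⟩⟩

include hℓ hm hβ in
/-- **The referee accepts exactly the histories the game accepts**: on a complete history `h`
(`2R + 3` moves of the common length `M ≥ max (2m) ℓ`),
`⟨x, enc h⟩ ∈ gsRef W γ kFin R ↔ GoldwasserSipser.Accepts p (W.game x m ℓ) h`.
[cite: AroraBarakCC2009, Thm. 8.12 (§8.2.3)] -/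
theorem mem_gsRef_iff_accepts (hM2 : 2 * p.m ≤ p.M) (hMℓ : p.ℓ ≤ p.M) (h : List (List Bool))
    (hh : h.length = 2 * p.R + 3) (hlen : ∀ w ∈ h, w.length = p.M) :
    boolPair x (encMoves h) ∈ gsRef W p.γ p.kFin p.R ↔ Accepts p (W.game x p.m p.ℓ) h := by
  obtain ⟨w₀, rest, rfl⟩ : ∃ w₀ rest, h = w₀ :: rest := by
    rcases h with _ | ⟨w₀, rest⟩
    · simp at hh
    · exact ⟨w₀, rest, rfl⟩
  have hrest : rest.length = 2 * p.R + 2 := by simp only [List.length_cons] at hh; omega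
  have hlen' : ∀ w ∈ rest, w.length = p.M := fun w hw => hlen w (by simp [hw])
  have hbkt : bktU W (boolPair x w₀) = ones (bktOf p w₀) := by rw [bktU_apply, hm, hℓ]; rfl
  have hmain := chkF_rec_iff_roundsAccept W x p hℓ hm hβ hM2 hMℓ p.R (init p w₀) 0 rest rfl hrest hlen'
  rw [mem_gsRef_iff, gsRefFn, Function.comp_apply, initRecF_apply, Accepts, ← hmain, hbkt, hℓ]
  simp only [init, and_true, List.map_nil, encList_nil]
  rfl

include hℓ hm hβ in
/-- **The referee payoff is the game's payoff** on complete histories. [cite: AroraBarakCC2009, Thm. 8.12 (§8.2.3)] -/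
theorem refereePayoff_gsRef_eq_payoff (hM2 : 2 * p.m ≤ p.M) (hMℓ : p.ℓ ≤ p.M) (h : List (List Bool))
    (hh : h.length = 2 * p.R + 3) (hlen : ∀ w ∈ h, w.length = p.M) :
    refereePayoff (gsRef W p.γ p.kFin p.R) x h = payoff p (W.game x p.m p.ℓ) h := by
  rw [show refereePayoff (gsRef W p.γ p.kFin p.R) x h =
      if boolPair x (encMoves h) ∈ gsRef W p.γ p.kFin p.R then 1 else 0 from rfl, payoff]
  exact if_congr (mem_gsRef_iff_accepts W x p hℓ hm hβ hM2 hMℓ h hh hlen) rfl rfl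

include hℓ hm hβ in
/-- **Merlin's winning chance against the Goldwasser–Sipser referee is the value of the
Goldwasser–Sipser game** (pattern `merlin.alternate (2R + 3)`, moves of length `M`).
[cite: AroraBarakCC2009, Thm. 8.12 (§8.2.3)] [cite: BabaiMoran1988, §2.3] -/
theorem amValue_gsRef_eq (hM2 : 2 * p.m ≤ p.M) (hMℓ : p.ℓ ≤ p.M) :
    amValue (gsRef W p.γ p.kFin p.R) p.M (merlin.alternate (2 * p.R + 3)) x =
      gameValue (payoff p (W.game x p.m p.ℓ)) p.M (merlin.alternate (2 * p.R + 3)) [] := by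
  rw [amValue]
  refine gameValue_congr_on _ _ _ _ [] fun C hC hCM => ?_
  rw [List.nil_append]
  exact refereePayoff_gsRef_eq_payoff W x p hℓ hm hβ hM2 hMℓ C (by rw [hC, length_alternate]) hCM

end Agreement

end GSRef

end Literature.Computability.Complexity

end
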